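import Mathlib
import Literature.Analysis.FluidPDE.VectorCalculus
import Summits.NavierStokesRegularity.NavierStokesRegularity.Theorems.FilamentSkeletonRssMatchedKernelDirectionalDeriv
import Summits.NavierStokesRegularity.NavierStokesRegularity.Theorems.FilamentSkeletonRssSelectionBoxRJRungPartnerStrain

/-!
# The MATCHED-CORE Biot–Savart field: the `1/D²` bound for its GRADIENT at distance `D` from the filament
# (variable core `m(u) ≥ 0`; for the `fderiv` form `m` continuous with a floor `m₀ > 0`)

Port of `…SelectionBoxRJRungPartnerStrain` (lane 19175-p1 g6, `+1`/constant core) to the matched kernel of the A1G cone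
(kit `retype_R-T_kit.md` §5(d) μ-parametrised restatements; the PARTNER ingredient of the determinant half of clause 12,
`RungNormalBlockDet`, and of the slip law's partner strain):

* `matched_gradIntegrand_norm_le` — the derivative integrand `−3⟪w, v⟫K₅ • X′u × w + K₃ • X′u × v`,
  `K_p = ((‖w‖² + q)^{p/2})⁻¹`, has norm `≤ 4‖v‖/‖w‖³` for ANY `q ≥ 0` (the core only helps);
* `matched_gradIntegral_bound` — if `y` sees the filament at distance `≥ D > 0` with linear escape
  `c|u − u₀| − A ≤ ‖y − X u‖`, the derivative integral has norm `≤ 8π‖v‖(D + A)/(c D³)` for ANY core profile `m ≥ 0`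
  (Cauchy majorant; no integrability needed);
* `matched_fderiv_norm_le`, `matched_axialStrain_le` — with `m` continuous, `m ≥ m₀ > 0` (so that `fderiv F y v` IS
  that integral, `MatchedKernel.matchedBiotSavart_fderiv_apply_eq`): `‖fderiv F y‖ ≤ 8π(D + A)/(c D³)` and
  `|⟪a, (fderiv F y) a⟫| ≤ 8π(D + A)/(c D³)` for unit `a` — the Γ-free `O(γ_k/d²)` partner strain, uniform in the core.

Lane ns-filament-19175-p1 g11; `--supports stmt-NavierStokesRegularity-27849`.  HONEST FRAMING: kernel estimates for a
HYPOTHETICAL filament skeleton on the NEGATIVE side of a MODEL route; nothing here bears on Navier–Stokes regularity or blow-up.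
-/

set_option linter.dupNamespace false

noncomputable section

namespace Summit.NavierStokesRegularity.NavierStokesRegularity.Theorems.MatchedKernel

open Set Function Filter MeasureTheory Real
open Literature.Analysis.FluidPDE
open Summit.NavierStokesRegularity.NavierStokesRegularity.Theorems.SelectionBoxRJRung
open scoped InnerProductSpace Topology

/-- Kernel bounds with a nonnegative core constant: `((r² + q)^{3/2})⁻¹ ≤ (r³)⁻¹`, `((r² + q)^{5/2})⁻¹ ≤ (r⁵)⁻¹` for
`0 < r`, `0 ≤ q`. [folklore] -/
theorem matched_kernel_le_inv_pow {r q : ℝ} (hr : 0 < r) (hq : 0 ≤ q) :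
    ((r ^ 2 + q) ^ (3 / 2 : ℝ))⁻¹ ≤ (r ^ 3)⁻¹ ∧ ((r ^ 2 + q) ^ (5 / 2 : ℝ))⁻¹ ≤ (r ^ 5)⁻¹ := by
  have h := rosenhead_kernel_le_inv_pow hr (Real.sqrt q)
  rwa [Real.sq_sqrt hq] at h

/-- **Pointwise bound for the matched derivative integrand**: with `r = ‖w‖ > 0`, `‖T‖ ≤ 1`, `q ≥ 0`, the vector
`−3⟪w, v⟫K₅ • T × w + K₃ • T × v` has norm `≤ 4‖v‖/r³`. [folklore] -/
theorem matched_gradIntegrand_norm_le {q : ℝ} (hq : 0 ≤ q) {T w v : EuclideanSpace ℝ (Fin 3)} (hT : ‖T‖ ≤ 1)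
    (hw : 0 < ‖w‖) :
    ‖(-3 * ⟪w, v⟫_ℝ * ((‖w‖ ^ 2 + q) ^ (5 / 2 : ℝ))⁻¹) • cross T w + ((‖w‖ ^ 2 + q) ^ (3 / 2 : ℝ))⁻¹ • cross T v‖ ≤
      4 * ‖v‖ / ‖w‖ ^ 3 := by
  have h := biotSavart_gradIntegrand_norm_le (Real.sqrt q) (v := v) hT hw
  rwa [Real.sq_sqrt hq] at h

/-- **Decay of the matched gradient integral.**  If `‖X′‖ ≤ 1`, the core profile is nonnegative, the point `y` is at
distance `≥ D > 0` from the whole filament and sees it with linear escape `c|u − u₀| − A ≤ ‖y − X u‖` (`c > 0`, `A ≥ 0`),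
then the derivative integral in the direction `v` has norm `≤ 8π‖v‖(D + A)/(c D³)` (no integrability needed). [folklore] -/
theorem matched_gradIntegral_bound {m : ℝ → ℝ} (hmnn : ∀ u, 0 ≤ m u) {c D A u₀ : ℝ} {X : ℝ → EuclideanSpace ℝ (Fin 3)}
    {y v : EuclideanSpace ℝ (Fin 3)} (hc : 0 < c) (hD : 0 < D) (hA : 0 ≤ A) (hdX : ∀ u, ‖deriv X u‖ ≤ 1)
    (hfar : ∀ u, D ≤ ‖y - X u‖) (hesc : ∀ u, c * |u - u₀| - A ≤ ‖y - X u‖) :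
    ‖∫ u : ℝ, ((-3 * ⟪y - X u, v⟫_ℝ * ((‖y - X u‖ ^ 2 + m u) ^ (5 / 2 : ℝ))⁻¹) • cross (deriv X u) (y - X u)
        + ((‖y - X u‖ ^ 2 + m u) ^ (3 / 2 : ℝ))⁻¹ • cross (deriv X u) v)‖ ≤
      8 * Real.pi * ‖v‖ * (D + A) / (c * D ^ 3) := by
  have hDA : 0 < D + A := by linarith
  set k : ℝ := c / (D + A) with hk
  have hkpos : 0 < k := div_pos hc hDA
  set g : ℝ → ℝ := fun u => 8 * ‖v‖ / D ^ 3 * (1 + (k * (u - u₀)) ^ 2)⁻¹ with hg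
  have hg_int : Integrable g := by
    have h0 : Integrable (fun u : ℝ => (1 + (k * u) ^ 2)⁻¹) := integrable_inv_one_add_sq.comp_mul_left' hkpos.ne'
    have h1 : Integrable (fun u : ℝ => (1 + (k * (u - u₀)) ^ 2)⁻¹) := h0.comp_sub_right u₀
    exact h1.const_mul _
  have hg_val : ∫ u, g u = 8 * ‖v‖ / D ^ 3 * ((D + A) / c * Real.pi) := by
    rw [hg, integral_const_mul]
    congr 1
    have h1 : ∫ u : ℝ, (1 + (k * (u - u₀)) ^ 2)⁻¹ = ∫ u : ℝ, (1 + (k * u) ^ 2)⁻¹ :=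
      integral_sub_right_eq_self (fun u : ℝ => (1 + (k * u) ^ 2)⁻¹) u₀
    rw [h1, Measure.integral_comp_mul_left (fun y : ℝ => (1 + y ^ 2)⁻¹), integral_univ_inv_one_add_sq,
      smul_eq_mul, hk, inv_div, abs_of_pos (div_pos hDA hc)]
  have hbound : ∀ u : ℝ,
      ‖(-3 * ⟪y - X u, v⟫_ℝ * ((‖y - X u‖ ^ 2 + m u) ^ (5 / 2 : ℝ))⁻¹) • cross (deriv X u) (y - X u)
        + ((‖y - X u‖ ^ 2 + m u) ^ (3 / 2 : ℝ))⁻¹ • cross (deriv X u) v‖ ≤ g u := by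
    intro u
    have hr : D ≤ ‖y - X u‖ := hfar u
    have hrpos : 0 < ‖y - X u‖ := lt_of_lt_of_le hD hr
    have h1 := matched_gradIntegrand_norm_le (hmnn u) (v := v) (hdX u) hrpos
    have hcore := cauchy_majorant_core hD hA hc hr (hesc u)
    have hkq : k * (u - u₀) = c * (u - u₀) / (D + A) := by rw [hk]; ring
    have hcore' : D ^ 2 * (1 + (k * (u - u₀)) ^ 2) ≤ 2 * ‖y - X u‖ ^ 2 := by rw [hkq]; exact hcore
    have hq : 0 < 1 + (k * (u - u₀)) ^ 2 := by positivity
    have hK : D ^ 2 / (2 * ‖y - X u‖ ^ 2) ≤ (1 + (k * (u - u₀)) ^ 2)⁻¹ := by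
      rw [inv_eq_one_div, div_le_div_iff₀ (by positivity) hq]
      nlinarith [hcore']
    have hmaj : 4 * ‖v‖ / ‖y - X u‖ ^ 3 ≤ g u := by
      show 4 * ‖v‖ / ‖y - X u‖ ^ 3 ≤ 8 * ‖v‖ / D ^ 3 * (1 + (k * (u - u₀)) ^ 2)⁻¹
      calc 4 * ‖v‖ / ‖y - X u‖ ^ 3 ≤ 4 * ‖v‖ / (D * ‖y - X u‖ ^ 2) := by
            refine div_le_div_of_nonneg_left (by positivity) (by positivity) ?_
            nlinarith [pow_pos hrpos 2, hr]
        _ = 8 * ‖v‖ / D ^ 3 * (D ^ 2 / (2 * ‖y - X u‖ ^ 2)) := by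
            field_simp
            ring
        _ ≤ 8 * ‖v‖ / D ^ 3 * (1 + (k * (u - u₀)) ^ 2)⁻¹ := mul_le_mul_of_nonneg_left hK (by positivity)
    exact h1.trans hmaj
  have hfin : 8 * ‖v‖ / D ^ 3 * ((D + A) / c * Real.pi) = 8 * Real.pi * ‖v‖ * (D + A) / (c * D ^ 3) := by
    field_simp
  calc _ ≤ ∫ u, g u := norm_integral_le_of_norm_le hg_int (Eventually.of_forall hbound)
    _ = 8 * ‖v‖ / D ^ 3 * ((D + A) / c * Real.pi) := hg_val
    _ = 8 * Real.pi * ‖v‖ * (D + A) / (c * D ^ 3) := hfin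

/-- **`1/D²` decay of the matched field gradient.**  With `m` continuous, `m ≥ m₀ > 0`, a `C¹` proper filament (`‖X′‖ ≤ 1`,
`c₀|u| − C ≤ ‖X u‖`), and `y` at distance `≥ D` from the filament with linear escape `c|u − u₀| − A ≤ ‖y − X u‖`:
`‖fderiv F y‖ ≤ 8π(D + A)/(c D³)`. [folklore] -/
theorem matched_fderiv_norm_le {m : ℝ → ℝ} {m₀ c₀ C c D A u₀ : ℝ} {X : ℝ → EuclideanSpace ℝ (Fin 3)}
    (hm₀ : 0 < m₀) (hm : ∀ u, m₀ ≤ m u) (hmc : Continuous m) (hc₀ : 0 < c₀) (hX : ContDiff ℝ 1 X)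
    (hdX : ∀ u, ‖deriv X u‖ ≤ 1) (hgrow : ∀ u, c₀ * |u| - C ≤ ‖X u‖)
    {y : EuclideanSpace ℝ (Fin 3)} (hc : 0 < c) (hD : 0 < D) (hA : 0 ≤ A)
    (hfar : ∀ u, D ≤ ‖y - X u‖) (hesc : ∀ u, c * |u - u₀| - A ≤ ‖y - X u‖) :
    ‖fderiv ℝ (fun y : EuclideanSpace ℝ (Fin 3) => ∫ u : ℝ,
        ((‖y - X u‖ ^ 2 + m u) ^ (3 / 2 : ℝ))⁻¹ • cross (deriv X u) (y - X u)) y‖ ≤ 8 * Real.pi * (D + A) / (c * D ^ 3) := by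
  have hmnn : ∀ u, 0 ≤ m u := fun u => hm₀.le.trans (hm u)
  refine ContinuousLinearMap.opNorm_le_bound _ (by positivity) fun v => ?_
  rw [matchedBiotSavart_fderiv_apply_eq hm₀ hm hmc hc₀ hX hdX hgrow y v]
  calc _ ≤ 8 * Real.pi * ‖v‖ * (D + A) / (c * D ^ 3) := matched_gradIntegral_bound hmnn hc hD hA hdX hfar hesc
    _ = 8 * Real.pi * (D + A) / (c * D ^ 3) * ‖v‖ := by ring

/-- **Matched partner axial strain bound.**  Under the same hypotheses, for every unit vector `a`,
`|⟪a, (fderiv F y) a⟫| ≤ 8π(D + A)/(c D³)`. [folklore] -/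
theorem matched_axialStrain_le {m : ℝ → ℝ} {m₀ c₀ C c D A u₀ : ℝ} {X : ℝ → EuclideanSpace ℝ (Fin 3)}
    (hm₀ : 0 < m₀) (hm : ∀ u, m₀ ≤ m u) (hmc : Continuous m) (hc₀ : 0 < c₀) (hX : ContDiff ℝ 1 X)
    (hdX : ∀ u, ‖deriv X u‖ ≤ 1) (hgrow : ∀ u, c₀ * |u| - C ≤ ‖X u‖)
    {y a : EuclideanSpace ℝ (Fin 3)} (ha : ‖a‖ = 1) (hc : 0 < c) (hD : 0 < D) (hA : 0 ≤ A)
    (hfar : ∀ u, D ≤ ‖y - X u‖) (hesc : ∀ u, c * |u - u₀| - A ≤ ‖y - X u‖) :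
    |⟪a, fderiv ℝ (fun y : EuclideanSpace ℝ (Fin 3) => ∫ u : ℝ,
        ((‖y - X u‖ ^ 2 + m u) ^ (3 / 2 : ℝ))⁻¹ • cross (deriv X u) (y - X u)) y a⟫_ℝ| ≤ 8 * Real.pi * (D + A) / (c * D ^ 3) := by
  have hop := matched_fderiv_norm_le (u₀ := u₀) hm₀ hm hmc hc₀ hX hdX hgrow hc hD hA hfar hesc
  set L := fderiv ℝ (fun y : EuclideanSpace ℝ (Fin 3) => ∫ u : ℝ,
        ((‖y - X u‖ ^ 2 + m u) ^ (3 / 2 : ℝ))⁻¹ • cross (deriv X u) (y - X u)) y with hL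
  calc |⟪a, L a⟫_ℝ| ≤ ‖a‖ * ‖L a‖ := abs_real_inner_le_norm a (L a)
    _ ≤ ‖a‖ * (‖L‖ * ‖a‖) := mul_le_mul_of_nonneg_left (L.le_opNorm a) (norm_nonneg _)
    _ = ‖L‖ := by rw [ha, one_mul, mul_one]
    _ ≤ 8 * Real.pi * (D + A) / (c * D ^ 3) := hop

end Summit.NavierStokesRegularity.NavierStokesRegularity.Theorems.MatchedKernel
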